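import Summits.BirchSwinnertonDyer.Rank1Residual.X2.MultControlAtomsNoLocalTorsion
import Summits.BirchSwinnertonDyer.Rank1Residual.X2.NonsplitControl
import Summits.BirchSwinnertonDyer.Rank1Residual.X2.SplitHalvesAssembly
import HarnessLib

/-!
# Class X2 at ANY multiplicative prime WITHOUT LOCAL `p`-TORSION: the anticyclotomic CONTROL THEOREM
# sign-free, and CTL-split (`X2.SplitControlOnTree`) as a THEOREM on the sub-row `p ∤ v_p(Δ_min)` =
# `p ∤ c_p(E)` (cell `bsd-eis`, seat `bsd-eis-cgshw` g8; route `EisensteinPrimes`, crux 4 `BSDpOnCellC`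
# = stmt-BirchSwinnertonDyer-19034, line b1, stub `stub_ctl_split`; THEOREMS ONLY)

HONEST FRAMING (cell `bsd-eis`): theorems only; nothing booked; X2 stays CONSTRUCTION-SHAPED; no label
or count moves. `X2/NonsplitBaseSelmerCount.lean` + `X2/NonsplitControl.lean` (cgshw gen 1–2, p398508)
assembled the control theorem `ControlOnTreeAt` at an X2c ∩ {non-split} datum from the cited
cohomological facts; `¬ split` entered only as `E(ℚ_p)[p] = 0`. With the bricks re-run under
`¬ split ∨ p ∤ v_p(Δ_min)` (`X2/MultControlAtomsNoLocalTorsion.lean`), the same assembly gives: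

* `baseSelmerCountAt_of_rankOne_of_noLocalPTorsion`, `controlOnTreeAt_of_atoms_of_noLocalPTorsion`,
  `controlOnTreeAt_of_noLocalPTorsion_of_rankOne`, `controlOnTreeAt_of_cellC_of_noLocalPTorsion` — the
  four theorems of the non-split assembly VERBATIM with `hns` replaced by `hlt`;
* **`splitControlOnTree_of_cellC_of_not_dvd`** — at a SPLIT X2c pair with `p ∤ v_p(Δ_min(E))`
  (equivalently `p ∤ c_p(E) = v_p(Δ_min)`, the split Tamagawa number): `SplitControlOnTree W p`, the
  body of the registered stub `stub_ctl_split`, from GZK, modularity and the FIVE cited cohomological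
  facts of the non-split theorem — NO Keller–Yin App. B, NO torsion bookkeeping. CTL-split's residual
  after this file is the sub-row `p ∣ c_p(E)` of the split X2c cells (there `E(ℚ_p)[p]` may be
  non-zero — exactly when `q_E ∈ (ℚ_p^×)^p` —, and MEMO-7 §2c (I1)–(I6) is the plan);
* `splitControlOnTree_residual_iff` is NOT claimed: nothing here says the residual sub-row is
  non-empty or hard; it records the dichotomy only through the hypothesis.

References: [Castella2018] Thm. 2.3; [JetchevSkinnerWan2017] Thm. 3.3.1, §3.3; [GreenbergLNM1716]
§3–4; [Brink2007] Thm. 2 / Cor. 1; [MilneADT2006] I.2.8, I.4.10; [SilvermanAEC2009] VII.6.1, Ex. 3.5,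
C.15 (split Tamagawa number `= v_p(Δ)`); cgshw MEMO-7 §2.
-/

set_option autoImplicit false

noncomputable section

open scoped Classical

open WeierstrassCurve NumberField IsDedekindDomain Field
open Literature.NumberTheory.EllipticCurves Literature.NumberTheory.EllipticCurves.GreenbergSelmer
  Literature.NumberTheory.EllipticCurves.ModularForms
  Literature.NumberTheory.EllipticCurves.Rank1Residual
  Literature.NumberTheory.EllipticCurves.Rank1Residual.Typed
  Literature.NumberTheory.GaloisRepresentations Literature.NumberTheory.GaloisCohomology
  Literature.NumberTheory.Automorphic
  Summit.BirchSwinnertonDyer.Rank1Residual.X11b.AcSelmer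
  Summit.BirchSwinnertonDyer.Rank1Residual.X11b.LocBridge
  Summit.BirchSwinnertonDyer.Rank1Residual.X11b

namespace Summit.BirchSwinnertonDyer.Rank1Residual.X2

variable (W : WeierstrassCurve ℚ) [W.IsElliptic] [W.IsGloballyMinimal] (p : ℕ) [Fact p.Prime]

/-- **Local-torsion-free form of `baseSelmerCountAt_of_rankOne_of_not_split`** (`X2/NonsplitBaseSelmerCount.lean`, cgshw; non-split) —
the same statement and proof VERBATIM with the sign hypothesis `hns : ¬ split` replaced by
`hlt : ¬ split ∨ p ∤ v_p(Δ_min)`, whose only use is `E(ℚ_p)[p] = 0`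
(`X11b.LocalTorsion.localTorsion_eq_zero_of_mult`, Silverman VII.6.1 / Ex. 3.5 and the Tate
parametrisation: at a SPLIT `p ≥ 3`, `E(ℚ_p)[p] ≠ 0` forces `p ∣ v_p(q_E) = v_p(Δ_min)`).
[cite: JetchevSkinnerWan2017, Prop. 3.2.1 and (7.1.5) (arXiv:1512.06894 pp. 10–11, 16)] [cite: SilvermanAEC2009, Thm VII.6.1 and Exercise 3.5] -/
theorem baseSelmerCountAt_of_rankOne_of_noLocalPTorsion (W : WeierstrassCurve ℚ) [W.IsElliptic]
    [W.IsGloballyMinimal] (p : ℕ) [Fact p.Prime] (K : Type) [Field K] [NumberField K]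
    (hPT : poitouTate_selmerStructure_duality K)
    (hEP : ∀ v : HeightOneSpectrum (𝓞 K), localEulerPoincareCharacteristic (v.adicCompletion K))
    (hp3 : 3 ≤ p) (hmult : Mult W p)
    (hlt : ¬ W.HasSplitMultiplicativeReductionAtPrime p ∨
      ¬ p ∣ padicValInt p W.minimalDiscriminantInt)
    (hK : IsImaginaryQuadratic K) (hsplit : SplitsIn K p)
    (hrank : (W.baseChange K).mordellWeilRank = 1) (hSha : (W.baseChange K).ShaFinite)
    (P : (W.baseChange K).toAffine.Point) (hPinf : ¬ IsOfFinAddOrder P)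
    (𝔭 : HeightOneSpectrum (𝓞 K)) (h𝔭 : ((p : ℕ) : 𝓞 K) ∈ 𝔭.asIdeal)
    (he : 𝔭.asIdeal.ramificationIdx (𝓞 ℚ) = 1) (hf : 𝔭.asIdeal.inertiaDeg (𝓞 ℚ) = 1) :
    BaseSelmerCountAt p 𝔭 (embAt K p 𝔭 h𝔭 he hf) P := by
  have hiv : ∀ R : (W.baseChange ℚ_[p]).toAffine.Point, p • R = 0 → R = 0 :=
    LocalTorsion.localTorsion_eq_zero_of_mult W p hp3 hmult hlt
  have hivK0 : ∀ Q : (W.baseChange K).toAffine.Point, p • Q = 0 → Q = 0 := by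
    intro Q hQ
    have hfinj : Function.Injective
        (Affine.Point.map (W' := W) (embAt K p 𝔭 h𝔭 he hf).toRatAlgHom :
          (W.baseChange K).toAffine.Point →+ (W.baseChange ℚ_[p]).toAffine.Point) :=
      Affine.Point.map_injective (W' := W) (embAt K p 𝔭 h𝔭 he hf).toRatAlgHom
    refine (injective_iff_map_eq_zero _).mp hfinj Q (hiv _ ?_)
    rw [← map_nsmul, hQ, map_zero]
  obtain ⟨hfin, a, hcard, ha⟩ := natCard_selmerAcBase_mul_eq_of_rankOne_of_noTorsion W p K hPT hEP
    hmult hivK0 hK hsplit hrank hSha P hPinf 𝔭 h𝔭 he hf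
  have hbot : AddCommGroup.primaryComponent (W.baseChange ℚ_[p]).toAffine.Point p = ⊥ := by
    refine (AddSubgroup.eq_bot_iff_forall _).mpr fun x hx => ?_
    obtain ⟨n, hn⟩ := (AddCommGroup.mem_primaryComponent).mp hx
    exact KummerDecomp.eq_zero_of_pow_nsmul_eq_zero p hiv n hn
  have h1 : Nat.card (AddCommGroup.primaryComponent (W.baseChange ℚ_[p]).toAffine.Point p) = 1 := by
    rw [hbot, AddSubgroup.card_bot]
  rw [h1, mul_one] at hcard
  exact ⟨a, ⟨hfin, hcard⟩, ha⟩

/-- **Local-torsion-free form of `controlOnTreeAt_of_atoms_of_not_split`** (`X2/NonsplitControl.lean`, cgshw; non-split) —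
the same statement and proof VERBATIM with the sign hypothesis `hns : ¬ split` replaced by
`hlt : ¬ split ∨ p ∤ v_p(Δ_min)`, whose only use is `E(ℚ_p)[p] = 0`
(`X11b.LocalTorsion.localTorsion_eq_zero_of_mult`, Silverman VII.6.1 / Ex. 3.5 and the Tate
parametrisation: at a SPLIT `p ≥ 3`, `E(ℚ_p)[p] ≠ 0` forces `p ∣ v_p(q_E) = v_p(Δ_min)`).
[cite: Castella2018, Thm. 2.3 (arXiv:1704.06608 p. 5)] [cite: JetchevSkinnerWan2017, Thm. 3.3.1 and §3.3.2–3.3.6 (arXiv:1512.06894 pp. 11–14)] -/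
theorem controlOnTreeAt_of_atoms_of_noLocalPTorsion (hp3 : 3 ≤ p) (hmult : Mult W p)
    (hlt : ¬ W.HasSplitMultiplicativeReductionAtPrime p ∨
      ¬ p ∣ padicValInt p W.minimalDiscriminantInt)
    {K : Type} [Field K] [NumberField K]
    (hK : IsImaginaryQuadratic K) (hsplit : SplitsIn K p) {κ : ZpExtension K p}
    (hκ : κ.IsAnticyclotomic) (γ : absoluteGaloisGroup K) [hγ : Fact (κ.IsTopGenerator γ)]
    (𝔭 : HeightOneSpectrum (𝓞 K)) (h𝔭 : ((p : ℕ) : 𝓞 K) ∈ 𝔭.asIdeal)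
    (he : 𝔭.asIdeal.ramificationIdx (𝓞 ℚ) = 1) (hf : 𝔭.asIdeal.inertiaDeg (𝓞 ℚ) = 1)
    (ι : K →+* ℚ_[p]) (P : (W.baseChange K).toAffine.Point) (h6 : BaseSelmerCountAt p 𝔭 ι P)
    (h9 : LocSurjAt (W.baseChange K) p 𝔭 (nPlusPlaces_finite (W := W) (p := p) hK.1))
    (h10 : CoinvariantsTrivialAt (W.baseChange K) p κ 𝔭 γ)
    (h11 : ∀ v ∈ nPlusPlaces W K p, LocalKernelOrderAt (W.baseChange K) p κ v) :
    ControlOnTreeAt p κ 𝔭 γ ι P := by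
  have hp : p.Prime := Fact.out
  rw [controlOnTreeAt_iff_card p κ 𝔭 γ ι P]
  obtain ⟨a, ⟨_, hcardK⟩, ha⟩ := h6
  set hfin := nPlusPlaces_finite (W := W) (p := p) (K := K) hK.1 with hfin_def
  have hpN : p ∣ W.conductorNorm ℤ := dvd_conductorNorm_of_mult hmult
  have hSp : ∀ v ∈ nPlusPlaces W K p, ((p : ℕ) : 𝓞 K) ∉ v.asIdeal :=
    fun v hv ↦ ((mem_nPlusPlaces_iff v).mp hv).1
  have hbij := controlMap_bijective_nPlus_of_noLocalPTorsion W p hp3 hmult hlt hK hκ hγ.out 𝔭 h𝔭 he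
      hf
  have hloc : localKerPi (W.baseChange K) p κ hfin ≤ (locSel (W.baseChange K) p 𝔭 hfin).range := by
    rw [AddMonoidHom.range_eq_top.mpr h9]
    exact le_top
  have hcard := natCard_endInvariants_empty_eq_mul_prod (hS := hfin) hSp γ hbij hloc
  have hprod : (∏ v ∈ hfin.toFinset,
      Nat.card (localKer κ.kerSubgroup ((W.baseChange K).geomPrimaryTorsion p) v)) =
      p ^ ∑ v ∈ hfin.toFinset, padicValNat p
        (((W.baseChange K).baseChange (v.adicCompletion K)).localTamagawaNumber
          (v.adicCompletionIntegers K)) := by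
    rw [← Finset.prod_pow_eq_pow_sum]
    refine Finset.prod_congr rfl fun v hv => ?_
    obtain ⟨_, hv'⟩ := h11 v (hfin.mem_toFinset.mp hv)
    exact hv'
  have hcoinv := natCard_endCoinvariants_eq_one_of_surjective _ h10
  refine ⟨a + ∑ v ∈ hfin.toFinset, padicValNat p
      (((W.baseChange K).baseChange (v.adicCompletion K)).localTamagawaNumber
        (v.adicCompletionIntegers K)), ⟨?_, ?_⟩, ?_⟩
  · refine Nat.finite_of_card_ne_zero ?_
    rw [hcard, hcardK, hprod, ← pow_add]
    exact pow_ne_zero _ hp.ne_zero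
  · rw [hcard, hcardK, hprod, hcoinv, mul_one, pow_add]
  · rw [Nat.cast_add, ha, padicValNat_tamagawaProductSplit_eq_above_add_sum W p hK.1 hsplit hpN]
    push_cast
    ring

/-- **Local-torsion-free form of `controlOnTreeAt_of_not_split_of_rankOne`** (`X2/NonsplitControl.lean`, cgshw; non-split) —
the same statement and proof VERBATIM with the sign hypothesis `hns : ¬ split` replaced by
`hlt : ¬ split ∨ p ∤ v_p(Δ_min)`, whose only use is `E(ℚ_p)[p] = 0`
(`X11b.LocalTorsion.localTorsion_eq_zero_of_mult`, Silverman VII.6.1 / Ex. 3.5 and the Tate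
parametrisation: at a SPLIT `p ≥ 3`, `E(ℚ_p)[p] ≠ 0` forces `p ∣ v_p(q_E) = v_p(Δ_min)`).
[cite: Castella2018, Thm. 2.3 (arXiv:1704.06608 p. 5)] [cite: JetchevSkinnerWan2017, Thm. 3.3.1, Prop. 3.2.1, Prop. 3.3.2, Lemma 3.3.3, Prop. 3.3.4 (arXiv:1512.06894 pp. 10–13)] [cite: Brink2007, Thm. 2 and Cor. 1 (pp. 2134–2136)] -/
theorem controlOnTreeAt_of_noLocalPTorsion_of_rankOne
    (hGZK : rank_eq_analyticRank_of_analyticRank_le_one) (hnf : exists_isNewformOf)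
    (hPT : ∀ (K : Type) [Field K] [NumberField K], poitouTate_selmerStructure_duality K)
    (hPT2 : ∀ (K : Type) [Field K] [NumberField K], poitouTate_sha_tateDual K)
    (hEP : ∀ (K : Type) [Field K] [NumberField K] (v : HeightOneSpectrum (𝓞 K)),
      localEulerPoincareCharacteristic (v.adicCompletion K))
    (hcd : fieldCdLE_two_of_numberField)
    (hBr : ∀ (K : Type) [Field K] [NumberField K] (p : ℕ) [Fact p.Prime],
      ZpExtension.decomp_not_le_kerSubgroup_of_isAnticyclotomic K p)
    (hp2 : p ≠ 2) (hmult : Mult W p)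
    (hlt : ¬ W.HasSplitMultiplicativeReductionAtPrime p ∨
      ¬ p ∣ padicValInt p W.minimalDiscriminantInt)
    (hr : W.analyticRank = 1) {K : Type} [Field K] [NumberField K] (hK : IsImaginaryQuadratic K)
    (hsplit : SplitsIn K p) (hLt : (W.quadraticTwist (NumberField.discr K : ℚ)).entireLFunction 1 ≠
        0)
    (P : (W.baseChange K).toAffine.Point) (hPinf : ¬ IsOfFinAddOrder P)
    (κ : ZpExtension K p) (hκ : κ.IsAnticyclotomic) (γ : absoluteGaloisGroup K)
    [hγ : Fact (κ.IsTopGenerator γ)] (𝔭 : HeightOneSpectrum (𝓞 K))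
    (h𝔭 : ((p : ℕ) : 𝓞 K) ∈ 𝔭.asIdeal) (he : 𝔭.asIdeal.ramificationIdx (𝓞 ℚ) = 1)
    (hf : 𝔭.asIdeal.inertiaDeg (𝓞 ℚ) = 1) :
    ControlOnTreeAt p κ 𝔭 γ (embAt K p 𝔭 h𝔭 he hf) P := by
  have hp : p.Prime := Fact.out
  have hp3 : 3 ≤ p := by
    rcases hp.eq_two_or_odd with h | h
    · exact absurd h hp2
    · have := hp.two_le
      omega
  obtain ⟨hrank, hSha⟩ := mordellWeilRank_eq_one_and_shaFinite_of_twist W hGZK hnf hr hK.1 hLt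
  -- (P6) at every degree-one prime above `p`
  have h6 : ∀ (𝔮 : HeightOneSpectrum (𝓞 K)) (h𝔮 : ((p : ℕ) : 𝓞 K) ∈ 𝔮.asIdeal)
      (he' : 𝔮.asIdeal.ramificationIdx (𝓞 ℚ) = 1) (hf' : 𝔮.asIdeal.inertiaDeg (𝓞 ℚ) = 1),
      BaseSelmerCountAt p 𝔮 (embAt K p 𝔮 h𝔮 he' hf') P := fun 𝔮 h𝔮 he' hf' ↦
    baseSelmerCountAt_of_rankOne_of_noLocalPTorsion W p K (hPT K) (hEP K) hp3 hmult hlt hK hsplit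
        hrank
      hSha P hPinf 𝔮 h𝔮 he' hf'
  have hfin : ∀ v : HeightOneSpectrum (𝓞 K), ((p : ℕ) : 𝓞 K) ∈ v.asIdeal →
      Finite (selmerAcBase (W.baseChange K) p v ∅) := fun v hv ↦ by
    obtain ⟨he', hf'⟩ := degreeOne_of_splitsIn hK.1 hsplit hv
    obtain ⟨a, ⟨hfinv, -⟩, -⟩ := h6 v hv he' hf'
    exact hfinv
  -- (L10)
  have h10 : CoinvariantsTrivialAt (W.baseChange K) p κ 𝔭 γ :=
    coinvariantsTrivialAt_of_noLocalPTorsion W p hp3 hmult hlt (hPT K) (hPT2 K) (hEP K) hcd hK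
        hsplit κ
      hγ.out h𝔭 he hf hfin
  -- (P9) from finiteness at the conjugate prime
  obtain ⟨σ, 𝔮, -, hne, h𝔮, -⟩ :=
    LocalIndexTransport.exists_conj_prime_of_splitsIn K p hK.1 hsplit h𝔭
  have h9 : LocSurjAt (W.baseChange K) p 𝔭 (nPlusPlaces_finite (W := W) (p := p) hK.1) :=
    locSurjAt_of_finite_conj_of_noLocalPTorsion W p hp3 hmult hlt (hPT K) (hEP K) hK κ h𝔭 he hf h𝔮
        hne
      (hfin 𝔮 h𝔮)
  -- (P11) from Brink's decomposition law, and the assembly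
  exact controlOnTreeAt_of_atoms_of_noLocalPTorsion W p hp3 hmult hlt hK hsplit hκ γ 𝔭 h𝔭 he hf
    (embAt K p 𝔭 h𝔭 he hf) P (h6 𝔭 h𝔭 he hf) h9 h10
    (r1LocalKernelOrderAt_of_anticyclotomicDecomposition W p hBr hp2 K hK κ hκ)

/-- **Local-torsion-free form of `controlOnTreeAt_of_cellC_of_not_split`** (`X2/NonsplitControl.lean`, cgshw; non-split) —
the same statement and proof VERBATIM with the sign hypothesis `hns : ¬ split` replaced by
`hlt : ¬ split ∨ p ∤ v_p(Δ_min)`, whose only use is `E(ℚ_p)[p] = 0`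
(`X11b.LocalTorsion.localTorsion_eq_zero_of_mult`, Silverman VII.6.1 / Ex. 3.5 and the Tate
parametrisation: at a SPLIT `p ≥ 3`, `E(ℚ_p)[p] ≠ 0` forces `p ∣ v_p(q_E) = v_p(Δ_min)`).
[cite: Castella2018, Thm. 2.3 (arXiv:1704.06608 p. 5)] [cite: JetchevSkinnerWan2017, Thm. 3.3.1 (arXiv:1512.06894 p. 11)] -/
theorem controlOnTreeAt_of_cellC_of_noLocalPTorsion
    (hGZK : rank_eq_analyticRank_of_analyticRank_le_one) (hnf : exists_isNewformOf)
    (hPT : ∀ (K : Type) [Field K] [NumberField K], poitouTate_selmerStructure_duality K)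
    (hPT2 : ∀ (K : Type) [Field K] [NumberField K], poitouTate_sha_tateDual K)
    (hEP : ∀ (K : Type) [Field K] [NumberField K] (v : HeightOneSpectrum (𝓞 K)),
      localEulerPoincareCharacteristic (v.adicCompletion K))
    (hcd : fieldCdLE_two_of_numberField)
    (hBr : ∀ (K : Type) [Field K] [NumberField K] (p : ℕ) [Fact p.Prime],
      ZpExtension.decomp_not_le_kerSubgroup_of_isAnticyclotomic K p)
    (hc : CellC W p)
    (hlt : ¬ W.HasSplitMultiplicativeReductionAtPrime p ∨
      ¬ p ∣ padicValInt p W.minimalDiscriminantInt)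
    {K : Type} [Field K] [NumberField K] (hK : IsImaginaryQuadratic K)
    (hHp : SatisfiesHeegnerHypothesis p K)
    (hLt : (W.quadraticTwist (NumberField.discr K : ℚ)).entireLFunction 1 ≠ 0)
    (P : (W.baseChange K).toAffine.Point) (hPinf : ¬ IsOfFinAddOrder P)
    (κ : ZpExtension K p) (hκ : κ.IsAnticyclotomic) (γ : absoluteGaloisGroup K)
    [Fact (κ.IsTopGenerator γ)] (𝔭 : HeightOneSpectrum (𝓞 K))
    (h𝔭 : ((p : ℕ) : 𝓞 K) ∈ 𝔭.asIdeal) (he : 𝔭.asIdeal.ramificationIdx (𝓞 ℚ) = 1)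
    (hf : 𝔭.asIdeal.inertiaDeg (𝓞 ℚ) = 1) :
    ControlOnTreeAt p κ 𝔭 γ (embAt K p 𝔭 h𝔭 he hf) P :=
  controlOnTreeAt_of_noLocalPTorsion_of_rankOne W p hGZK hnf hPT hPT2 hEP hcd hBr hc.2.1 hc.2.2.2
      hlt hc.1 hK
    (hHp p Fact.out dvd_rfl) hLt P hPinf κ hκ γ 𝔭 h𝔭 he hf

/-! ### CTL-split on the sub-row `p ∤ v_p(Δ_min)` -/

/-- **CTL-split as a THEOREM on the sub-row `p ∤ v_p(Δ_min(E))`**: for a rank-one X2 pair `(E,p)`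
(`CellC W p`) with `p ∤ v_p(Δ_min)` — at a split `p` this is `p ∤ c_p(E)` —, `SplitControlOnTree W p`
(the body of line b1's registered stub `stub_ctl_split`: `ControlOnTreeAt` at every CGLS datum of the
pair at the split sign) holds, from GZK / modularity and the five cited cohomological facts of the
non-split control theorem. Proof: `controlOnTreeAt_of_cellC_of_noLocalPTorsion` with `hlt := Or.inr hv`;
the split hypothesis of `SplitControlOnTree` is not even used. CONDITIONAL on the cited facts; nothing
booked; no label change. [cite: Castella2018, Thm. 2.3 (arXiv:1704.06608 p. 5)]
[cite: JetchevSkinnerWan2017, Thm. 3.3.1 (arXiv:1512.06894 p. 11)]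
[cite: SilvermanAEC2009, Thm VII.6.1 and Exercise 3.5] -/
theorem splitControlOnTree_of_cellC_of_not_dvd
    (hGZK : rank_eq_analyticRank_of_analyticRank_le_one) (hnf : exists_isNewformOf)
    (hPT : ∀ (K : Type) [Field K] [NumberField K], poitouTate_selmerStructure_duality K)
    (hPT2 : ∀ (K : Type) [Field K] [NumberField K], poitouTate_sha_tateDual K)
    (hEP : ∀ (K : Type) [Field K] [NumberField K] (v : HeightOneSpectrum (𝓞 K)),
      localEulerPoincareCharacteristic (v.adicCompletion K))
    (hcd : fieldCdLE_two_of_numberField)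
    (hBr : ∀ (K : Type) [Field K] [NumberField K] (p : ℕ) [Fact p.Prime],
      ZpExtension.decomp_not_le_kerSubgroup_of_isAnticyclotomic K p)
    (hc : CellC W p) (hv : ¬ p ∣ padicValInt p W.minimalDiscriminantInt) :
    SplitControlOnTree W p := by
  intro K _ _ P _ _ hK hHp hLt hPinf κ hκ γ _ 𝔭 h𝔭 he hf
  exact controlOnTreeAt_of_cellC_of_noLocalPTorsion W p hGZK hnf hPT hPT2 hEP hcd hBr hc (Or.inr hv) hK
    hHp hLt P hPinf κ hκ γ 𝔭 h𝔭 he hf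

/-- **The registered stub's shape on the sub-row, class-wide**: the five cited facts + GZK + modularity
⟹ `∀ W p, CellC W p → split → p ∤ v_p(Δ_min W) → SplitControlOnTree W p` — i.e. `stub_ctl_split`
restricted to `p ∤ c_p`. What remains of CTL-split is `∀ W p, CellC W p → split → p ∣ v_p(Δ_min W) →
SplitControlOnTree W p`. CONDITIONAL on the cited facts; nothing booked.
[cite: Castella2018, Thm. 2.3 (arXiv:1704.06608 p. 5)] [cite: SilvermanAEC2009, Thm VII.6.1 and Exercise 3.5] -/
theorem splitControlOnTree_forall_of_not_dvd
    (hGZK : rank_eq_analyticRank_of_analyticRank_le_one) (hnf : exists_isNewformOf)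
    (hPT : ∀ (K : Type) [Field K] [NumberField K], poitouTate_selmerStructure_duality K)
    (hPT2 : ∀ (K : Type) [Field K] [NumberField K], poitouTate_sha_tateDual K)
    (hEP : ∀ (K : Type) [Field K] [NumberField K] (v : HeightOneSpectrum (𝓞 K)),
      localEulerPoincareCharacteristic (v.adicCompletion K))
    (hcd : fieldCdLE_two_of_numberField)
    (hBr : ∀ (K : Type) [Field K] [NumberField K] (p : ℕ) [Fact p.Prime],
      ZpExtension.decomp_not_le_kerSubgroup_of_isAnticyclotomic K p) :
    ∀ (W : WeierstrassCurve ℚ) [W.IsElliptic] [W.IsGloballyMinimal] (p : ℕ) [Fact p.Prime],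
      CellC W p → W.HasSplitMultiplicativeReductionAtPrime p →
        ¬ p ∣ padicValInt p W.minimalDiscriminantInt → SplitControlOnTree W p :=
  fun W _ _ p _ hc _ hv ↦ splitControlOnTree_of_cellC_of_not_dvd W p hGZK hnf hPT hPT2 hEP hcd hBr hc hv

end Summit.BirchSwinnertonDyer.Rank1Residual.X2

end
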